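import Literature.MathematicalPhysics.QuantumFieldTheory.ConformalBootstrap3D.PointKernelK34L505Data
import Literature.MathematicalPhysics.QuantumFieldTheory.ConformalBootstrap3D.PointKernelK34L505XSegs
import Literature.MathematicalPhysics.QuantumFieldTheory.ConformalBootstrap3D.PointKernelInterval

/-!
# K34L505 certificate, closed-box extension, kernel block file XE2: sliver segments `0 ≤ i < 2`

`decide` by kernel reduction on the LANDED piece certificates `pcP_iK34L505 = certK34L505.withS …` of
`PointKernelK34L505Data`; block checker `PCert.hBlockOKI` of `PointKernelInterval`; segment table `PointKernelK34L505XSegs`.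
Estimated kernel time 225 s (6 theorems).
-/

set_option maxRecDepth 100000
set_option maxHeartbeats 0

namespace Literature.MathematicalPhysics.QuantumFieldTheory.ConformalBootstrap3D.PointKernelK34L505X

open Literature.MathematicalPhysics.QuantumFieldTheory.ConformalBootstrap3D.PointKernel Literature.MathematicalPhysics.QuantumFieldTheory.ConformalBootstrap3D.PointKernelK34L505

/-- sliver segment 0 passes the interval-rule kernel evaluator on piece 12 of the 16-piece `s`-cover (≈36 s of kernel work). [folklore] -/
theorem exBlock_0_16_12 : pc16_12K34L505.hBlockOKI esegsXK34L505 0 1 JEXK34L505 = true := by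
  decide +kernel

/-- sliver segment 0 passes the interval-rule kernel evaluator on piece 13 of the 16-piece `s`-cover (≈36 s of kernel work). [folklore] -/
theorem exBlock_0_16_13 : pc16_13K34L505.hBlockOKI esegsXK34L505 0 1 JEXK34L505 = true := by
  decide +kernel

/-- sliver segment 0 passes the interval-rule kernel evaluator on piece 14 of the 16-piece `s`-cover (≈36 s of kernel work). [folklore] -/
theorem exBlock_0_16_14 : pc16_14K34L505.hBlockOKI esegsXK34L505 0 1 JEXK34L505 = true := by
  decide +kernel

/-- sliver segment 0 passes the interval-rule kernel evaluator on piece 15 of the 16-piece `s`-cover (≈36 s of kernel work). [folklore] -/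
theorem exBlock_0_16_15 : pc16_15K34L505.hBlockOKI esegsXK34L505 0 1 JEXK34L505 = true := by
  decide +kernel

/-- sliver segment 1 passes the interval-rule kernel evaluator on piece 0 of the 16-piece `s`-cover (≈36 s of kernel work). [folklore] -/
theorem exBlock_1_16_0 : pc16_0K34L505.hBlockOKI esegsXK34L505 1 2 JEXK34L505 = true := by
  decide +kernel

/-- sliver segment 1 passes the interval-rule kernel evaluator on piece 1 of the 16-piece `s`-cover (≈36 s of kernel work). [folklore] -/
theorem exBlock_1_16_1 : pc16_1K34L505.hBlockOKI esegsXK34L505 1 2 JEXK34L505 = true := by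
  decide +kernel

end Literature.MathematicalPhysics.QuantumFieldTheory.ConformalBootstrap3D.PointKernelK34L505X
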